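import Mathlib
import Literature.Analysis.FluidPDE.SelfSimilarEulerProfile
import Literature.Analysis.FluidPDE.VectorCalculus
import HarnessLib

/-!
# LEVEL QUANTIFIER of THE ONE STATEMENT's Bernoulli binders: «for every classical pressure» = «for one classical pressure»
# (crux `EulerZoomLiouville.PowerGaugeEulerLiouville` = stmt-NavierStokesRegularity-19832, line `birth`; RESIDUE-MEMO-19832-g12 §2 T4)

Route `EulerZoomLiouville` (NavierStokesRegularity); width seat ns-ezl-w6 g2 (LEAD ns-typeII-p2 g12).  The three needle binders of the skeleton
(`HasBernoulliPiercing`, `HasVorticalBernoulliBound`, `HasFastVorticalChannel`, v61) quantify over EVERY classical pressure `P′` of the `C²` profile `V`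
(`IsSelfSimilarEulerProfile γ 0 V P′`, CIV (3.3)).  Two classical pressures of one profile differ by a constant — POINTWISE, straight from (3.3):
`∇P′ = −(1−γ)V − DV[γy + V]` determines `∇P′` (`Loc.classicalPressure_eq_add_const`; no measure theory, no bridge) — and CIV's Bernoulli function is affine
in the pressure (`Loc.selfSimilarBernoulli_add_const`), so each binder holds for ALL classical pressures as soon as it holds for ONE:
`Loc.hasBernoulliPiercing_of_exists`, `Loc.hasVorticalBernoulliBound_of_exists`, `Loc.hasFastVorticalChannel_of_exists` (conclusions = the v61 binder
bodies VERBATIM, hypotheses = the same bodies under `∃ P′`; the level `h` shifts by the constant, the sub-critical pressure clause keeps a margin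
`ε″ = (ε + γ(1−γ)/2)/2` at a larger radius).  Use: the needle (their negations) may be registered / attacked with ONE exhibited pressure (cdisprove D1 families).
WHAT THIS IS NOT: not NS, not E — quantifier bookkeeping on the MODEL lattice, `--supports` stmt-19832; fillers unchanged; 19832 OPEN. [folklore; ConstantinIgnatovaVicol2026Putative §3.1.1 (3.3), §3.4.3 (3.30)]
-/

noncomputable section

-- flat `Theorems/<Route><Decl>…` files of one crux share the namespace of the crux (tree convention: `Summit.<S>.<S>.…`)
set_option linter.dupNamespace false

open MeasureTheory Set Filter Topology Metric Function TopologicalSpace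
open scoped ENNReal NNReal

namespace Summit.NavierStokesRegularity.NavierStokesRegularity.Theorems.PowerGaugeEulerLiouville

open Literature.Analysis Literature.Analysis.FluidPDE

namespace Loc

variable {γ : ℝ} {c : EuclideanSpace ℝ (Fin 3)} {V : EuclideanSpace ℝ (Fin 3) → EuclideanSpace ℝ (Fin 3)}
  {P₁ P₂ : EuclideanSpace ℝ (Fin 3) → ℝ}

/-! ### Two classical pressures differ by a constant -/

/-- **Two classical pressures of one profile differ by a constant**: if `(V, P₁)` and `(V, P₂)` both satisfy CIV (3.3) with the same exponent and
centre, then `P₂ = P₁ + c₀` for some constant `c₀` (the profile equation determines `∇P`; `ℝ³` is connected). [folklore] -/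
theorem classicalPressure_eq_add_const (h₁ : IsSelfSimilarEulerProfile γ c V P₁) (h₂ : IsSelfSimilarEulerProfile γ c V P₂) :
    ∃ c₀ : ℝ, ∀ y, P₂ y = P₁ y + c₀ := by
  have hd₁ : Differentiable ℝ P₁ := h₁.differentiable_pressure
  have hd₂ : Differentiable ℝ P₂ := h₂.differentiable_pressure
  -- the gradients agree pointwise
  have hgrad : ∀ y, gradient P₂ y = gradient P₁ y := by
    intro y
    have e₁ := h₁.profile_eq y
    have e₂ := h₂.profile_eq y
    have : gradient P₁ y = -((1 - γ) • V y + fderiv ℝ V y (γ • (y - c) + V y)) := by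
      rw [eq_neg_iff_add_eq_zero, add_comm]; exact e₁
    rw [this, eq_neg_iff_add_eq_zero, add_comm]; exact e₂
  -- hence the Fréchet derivatives of `P₂ − P₁` vanish
  have hfd : ∀ y, fderiv ℝ (fun y => P₂ y - P₁ y) y = 0 := by
    intro y
    have h1 : fderiv ℝ P₂ y = fderiv ℝ P₁ y := by
      have := congrArg (InnerProductSpace.toDual ℝ (EuclideanSpace ℝ (Fin 3))) (hgrad y)
      simpa [gradient] using this
    rw [fderiv_fun_sub (hd₂ y) (hd₁ y), h1, sub_self]
  refine ⟨P₂ 0 - P₁ 0, fun y => ?_⟩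
  have key : P₂ y - P₁ y = P₂ 0 - P₁ 0 :=
    is_const_of_fderiv_eq_zero (𝕜 := ℝ) (f := fun y => P₂ y - P₁ y) (hd₂.sub hd₁) hfd y 0
  linarith

/-- CIV's Bernoulli function is affine in the pressure: `ℋ_{P + c₀} = ℋ_P + c₀`. [folklore] -/
theorem selfSimilarBernoulli_add_const {P : EuclideanSpace ℝ (Fin 3) → ℝ} (c₀ : ℝ) (y : EuclideanSpace ℝ (Fin 3)) :
    selfSimilarBernoulli γ c V (fun y => P y + c₀) y = selfSimilarBernoulli γ c V P y + c₀ := by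
  simp only [selfSimilarBernoulli_apply]
  ring

/-- Bernoulli functions of two classical pressures of one profile differ by the same constant. [folklore] -/
theorem selfSimilarBernoulli_eq_add_const (h₁ : IsSelfSimilarEulerProfile γ c V P₁) (h₂ : IsSelfSimilarEulerProfile γ c V P₂) :
    ∃ c₀ : ℝ, (∀ y, P₂ y = P₁ y + c₀) ∧ ∀ y, selfSimilarBernoulli γ c V P₂ y = selfSimilarBernoulli γ c V P₁ y + c₀ := by
  obtain ⟨c₀, hc₀⟩ := classicalPressure_eq_add_const h₁ h₂
  refine ⟨c₀, hc₀, fun y => ?_⟩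
  have hP : P₂ = fun y => P₁ y + c₀ := funext hc₀
  rw [hP, selfSimilarBernoulli_add_const]

/-! ### The three binders: one pressure suffices -/

variable {ρ : ℝ}

/-- **BERNOULLI PIERCING FOR ONE CLASSICAL PRESSURE GIVES IT FOR ALL** (the body of the skeleton's `HasBernoulliPiercing ρ V`, v48–v61): the level `h`
for `P″ = P′ + c₀` is the level `h − c₀` for `P′`. [folklore] -/
theorem hasBernoulliPiercing_of_exists
    (h : ∃ P' : EuclideanSpace ℝ (Fin 3) → ℝ, IsSelfSimilarEulerProfile (1 / (2 + ρ)) 0 V P' ∧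
      ∀ h R₀ : ℝ, ∃ R : ℝ, R₀ ≤ R ∧ ∀ y : EuclideanSpace ℝ (Fin 3), ‖y‖ = R →
        inner ℝ y (V y) ≤ -(1 / (2 + ρ) * ‖y‖ ^ 2) →
          (curl V y = 0 ∨ selfSimilarBernoulli (1 / (2 + ρ)) 0 V P' y < h)) :
    ∀ P' : EuclideanSpace ℝ (Fin 3) → ℝ, IsSelfSimilarEulerProfile (1 / (2 + ρ)) 0 V P' →
      ∀ h R₀ : ℝ, ∃ R : ℝ, R₀ ≤ R ∧ ∀ y : EuclideanSpace ℝ (Fin 3), ‖y‖ = R →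
        inner ℝ y (V y) ≤ -(1 / (2 + ρ) * ‖y‖ ^ 2) →
          (curl V y = 0 ∨ selfSimilarBernoulli (1 / (2 + ρ)) 0 V P' y < h) := by
  obtain ⟨P₁, hP₁, hpier⟩ := h
  intro P₂ hP₂ h R₀
  obtain ⟨c₀, -, hB⟩ := selfSimilarBernoulli_eq_add_const hP₁ hP₂
  obtain ⟨R, hR, hy⟩ := hpier (h - c₀) R₀
  refine ⟨R, hR, fun y hyR hfast => ?_⟩
  rcases hy y hyR hfast with h0 | hlt
  · exact Or.inl h0
  · right
    rw [hB y]
    linarith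

/-- **THE VORTICAL BERNOULLI BOUND FOR ONE CLASSICAL PRESSURE GIVES IT FOR ALL** (the body of `HasVorticalBernoulliBound ρ V`, v52–v61): the ℋ-bound
shifts by `c₀`; the sub-critical pressure clause `P′ ≤ ε‖y‖²` (`ε < γ(1−γ)/2`) survives with `ε″ = (ε + γ(1−γ)/2)/2` beyond a larger radius. [folklore] -/
theorem hasVorticalBernoulliBound_of_exists
    (h : ∃ P' : EuclideanSpace ℝ (Fin 3) → ℝ, IsSelfSimilarEulerProfile (1 / (2 + ρ)) 0 V P' ∧
      (∃ Mb : ℝ, ∀ y : EuclideanSpace ℝ (Fin 3), curl V y ≠ 0 → selfSimilarBernoulli (1 / (2 + ρ)) 0 V P' y ≤ Mb) ∧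
      (∃ ε R₀ : ℝ, ε < (1 / (2 + ρ)) * (1 - 1 / (2 + ρ)) / 2 ∧
        ∀ y : EuclideanSpace ℝ (Fin 3), R₀ ≤ ‖y‖ → curl V y ≠ 0 → P' y ≤ ε * ‖y‖ ^ 2)) :
    ∀ P' : EuclideanSpace ℝ (Fin 3) → ℝ, IsSelfSimilarEulerProfile (1 / (2 + ρ)) 0 V P' →
      (∃ Mb : ℝ, ∀ y : EuclideanSpace ℝ (Fin 3), curl V y ≠ 0 → selfSimilarBernoulli (1 / (2 + ρ)) 0 V P' y ≤ Mb) ∧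
      (∃ ε R₀ : ℝ, ε < (1 / (2 + ρ)) * (1 - 1 / (2 + ρ)) / 2 ∧
        ∀ y : EuclideanSpace ℝ (Fin 3), R₀ ≤ ‖y‖ → curl V y ≠ 0 → P' y ≤ ε * ‖y‖ ^ 2) := by
  obtain ⟨P₁, hP₁, ⟨Mb, hMb⟩, ⟨ε, R₀, hε, hPε⟩⟩ := h
  intro P₂ hP₂
  obtain ⟨c₀, hc₀, hB⟩ := selfSimilarBernoulli_eq_add_const hP₁ hP₂
  refine ⟨⟨Mb + c₀, fun y hy => by rw [hB y]; linarith [hMb y hy]⟩, ?_⟩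
  -- the pressure clause with a margin
  set θ : ℝ := (1 / (2 + ρ)) * (1 - 1 / (2 + ρ)) / 2 with hθ
  set ε' : ℝ := (ε + θ) / 2 with hε'
  have hε'θ : ε' < θ := by rw [hε']; linarith
  have hgap : 0 < ε' - ε := by rw [hε']; linarith
  -- radius beyond which `c₀ ≤ (ε′ − ε)‖y‖²`
  set R₁ : ℝ := max R₀ (max 1 (|c₀| / (ε' - ε))) with hR₁
  refine ⟨ε', R₁, hε'θ, fun y hy hcurl => ?_⟩
  have hyR₀ : R₀ ≤ ‖y‖ := le_trans (le_max_left _ _) hy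
  have hy1 : 1 ≤ ‖y‖ := le_trans ((le_max_left _ _).trans (le_max_right _ _)) hy
  have hyc : |c₀| / (ε' - ε) ≤ ‖y‖ := le_trans ((le_max_right _ _).trans (le_max_right _ _)) hy
  have hc₀le : c₀ ≤ (ε' - ε) * ‖y‖ ^ 2 := by
    have h1 : |c₀| ≤ (ε' - ε) * ‖y‖ := by rwa [div_le_iff₀ hgap, mul_comm] at hyc
    have h2 : (ε' - ε) * ‖y‖ ≤ (ε' - ε) * ‖y‖ ^ 2 := by
      apply mul_le_mul_of_nonneg_left _ hgap.le
      nlinarith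
    linarith [le_abs_self c₀]
  rw [hc₀ y]
  have := hPε y hyR₀ hcurl
  nlinarith

/-- **THE FAST VORTICAL CHANNEL FOR ONE CLASSICAL PRESSURE GIVES IT FOR ALL** (the pressure-quantified part of the body of `HasFastVorticalChannel ρ V`, v60–v61,
with the same rate `c₁`): the high set `{ℋ_{P″} > h}` is the high set `{ℋ_{P′} > h − c₀}`. [folklore] -/
theorem hasFastVorticalChannel_of_exists {c₁ : ℝ}
    (h : ∃ P' : EuclideanSpace ℝ (Fin 3) → ℝ, IsSelfSimilarEulerProfile (1 / (2 + ρ)) 0 V P' ∧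
      ∀ h : ℝ, ∃ R₀ : ℝ, ∀ y : EuclideanSpace ℝ (Fin 3), R₀ ≤ ‖y‖ → h < selfSimilarBernoulli (1 / (2 + ρ)) 0 V P' y →
        curl V y ≠ 0 → inner ℝ y (selfSimilarTransport (1 / (2 + ρ)) 0 V y) ≤ -(c₁ * ‖y‖ ^ 2)) :
    ∀ P' : EuclideanSpace ℝ (Fin 3) → ℝ, IsSelfSimilarEulerProfile (1 / (2 + ρ)) 0 V P' →
      ∀ h : ℝ, ∃ R₀ : ℝ, ∀ y : EuclideanSpace ℝ (Fin 3), R₀ ≤ ‖y‖ → h < selfSimilarBernoulli (1 / (2 + ρ)) 0 V P' y →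
        curl V y ≠ 0 → inner ℝ y (selfSimilarTransport (1 / (2 + ρ)) 0 V y) ≤ -(c₁ * ‖y‖ ^ 2) := by
  obtain ⟨P₁, hP₁, hch⟩ := h
  intro P₂ hP₂ h
  obtain ⟨c₀, -, hB⟩ := selfSimilarBernoulli_eq_add_const hP₁ hP₂
  obtain ⟨R₀, hy⟩ := hch (h - c₀)
  refine ⟨R₀, fun y hyR hhigh hcurl => hy y hyR ?_ hcurl⟩
  rw [hB y] at hhigh
  linarith

/-- **The full `HasFastVorticalChannel ρ V` body from one pressure** (linear growth conjunct passed through). [folklore] -/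
theorem hasFastVorticalChannel_of_exists'
    (hlin : ∃ K₁ : ℝ, ∀ y : EuclideanSpace ℝ (Fin 3), ‖V y‖ ≤ K₁ * (1 + ‖y‖))
    (h : ∃ c₁ : ℝ, 1 / ((2 + ρ) * (1 + ρ)) < c₁ ∧ ∃ P' : EuclideanSpace ℝ (Fin 3) → ℝ,
      IsSelfSimilarEulerProfile (1 / (2 + ρ)) 0 V P' ∧
      ∀ h : ℝ, ∃ R₀ : ℝ, ∀ y : EuclideanSpace ℝ (Fin 3), R₀ ≤ ‖y‖ → h < selfSimilarBernoulli (1 / (2 + ρ)) 0 V P' y →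
        curl V y ≠ 0 → inner ℝ y (selfSimilarTransport (1 / (2 + ρ)) 0 V y) ≤ -(c₁ * ‖y‖ ^ 2)) :
    (∃ K₁ : ℝ, ∀ y : EuclideanSpace ℝ (Fin 3), ‖V y‖ ≤ K₁ * (1 + ‖y‖)) ∧
      ∃ c₁ : ℝ, 1 / ((2 + ρ) * (1 + ρ)) < c₁ ∧
        ∀ P' : EuclideanSpace ℝ (Fin 3) → ℝ, IsSelfSimilarEulerProfile (1 / (2 + ρ)) 0 V P' →
          ∀ h : ℝ, ∃ R₀ : ℝ, ∀ y : EuclideanSpace ℝ (Fin 3), R₀ ≤ ‖y‖ → h < selfSimilarBernoulli (1 / (2 + ρ)) 0 V P' y →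
            curl V y ≠ 0 → inner ℝ y (selfSimilarTransport (1 / (2 + ρ)) 0 V y) ≤ -(c₁ * ‖y‖ ^ 2) := by
  obtain ⟨c₁, hc₁, hP⟩ := h
  exact ⟨hlin, c₁, hc₁, hasFastVorticalChannel_of_exists hP⟩

end Loc

end Summit.NavierStokesRegularity.NavierStokesRegularity.Theorems.PowerGaugeEulerLiouville
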